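import Literature.RingTheory.Flat.AmitsurDegreeZero
import Mathlib.RingTheory.IsTensorProduct
import HarnessLib

/-!
# Amitsur descent in degree zero, in base-change DATA form (what the sections of a pulled-back sheaf satisfy)

Topic `Literature/RingTheory/Flat`, namespace `Literature.RingTheory.Flat`.  THEOREMS ONLY; no definition, no named fact, no
instance, no notation, no `sorry`.

[StacksProject, Tag 023M] / [GortzWedhorn2020, Thm. 14.66] (fpqc descent of sections of quasi-coherent sheaves) read on one
affine chart: instead of the literal modules `S ⊗_R N` and `(S ⊗_R S) ⊗_R N` of ★ `AmitsurDegreeZero`, the data are given up to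
isomorphism — as they arise from a quasi-coherent sheaf `M` on `X`, an fpqc cover `g : Z → X` and its kernel pair
`p₁, p₂ : Z ×_X Z ⇉ Z` on affine charts `V ⊆ X`, `U = g⁻¹V`, `U₂ = p₁⁻¹U ∩ p₂⁻¹U`:

* rings `R → S` faithfully flat (`Γ(V) → Γ(U)`) and `R`-algebra maps `ψ₁ ψ₂ : S → S₂` (`pᵢ^♯ : Γ(U) → Γ(U₂)`) exhibiting `S₂` as
  `S ⊗_R S` — hypothesis: `Algebra.TensorProduct.lift ψ₁ ψ₂ _ : S ⊗_R S → S₂` is bijective (the pushout square of the kernel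
  pair, Mathlib `isIso_pushoutSection_of_isAffineOpen`);
* an `R`-module `N` (`Γ(V, M)`), an `S`-module `P` with `j : N → P` a BASE CHANGE (`IsBaseChange S j`: `Γ(U, g^*M)` with
  `m ↦ η(m)|_U`, ★ `Modules/CechBaseChangeHom.isBaseChange_unitSectionLE`) and an `S₂`-module `P₂` with a base change
  `j₂ : N → P₂` (`Γ(U₂, (p₁ ≫ g)^*M)`);
* two additive maps `δ₁ δ₂ : P → P₂`, `ψᵢ`-semilinear and with `δᵢ ∘ j = j₂` (the two pull-backs of sections `pᵢ^*`).

Then: `injective_of_isBaseChange` — `j` is injective; **`eq_iff_mem_range_of_isBaseChange`** — `δ₁ x = δ₂ x ↔ x ∈ range j`;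
`existsUnique_of_isBaseChange` — the `∃!` form.  Proof: transport to ★ `mem_range_mk_one_iff_rTensor` along
`IsBaseChange.equiv` and the bijection `(S ⊗_R S) ⊗_R N ≅ S₂ ⊗_R N ≅ P₂`.  Cell `hodgecm-mathlib`, brick (β) of the HECKE-LINK D6
road; HC_CM is proved only modulo the 7 printed citations until rung 0 closes; nothing here is about HC.

## References
* [StacksProject] The Stacks Project, Tag 023M (Descent, Lemma 35.3.6).
* [GortzWedhorn2020] U. Görtz, T. Wedhorn, *Algebraic Geometry I*, 2nd ed. (2020), Thm. 14.66.
* [SGA1] A. Grothendieck, *SGA 1*, Exp. VIII §1.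
-/

universe u v w

open TensorProduct

namespace Literature.RingTheory.Flat

variable {R : Type u} {S S₂ : Type v} [CommRing R] [CommRing S] [CommRing S₂] [Algebra R S] [Algebra R S₂]
  (ψ₁ ψ₂ : S →ₐ[R] S₂)
  {N : Type w} [AddCommGroup N] [Module R N]
  {P : Type w} [AddCommGroup P] [Module R P] [Module S P] [IsScalarTower R S P] (j : N →ₗ[R] P)
  {P₂ : Type w} [AddCommGroup P₂] [Module R P₂] [Module S₂ P₂] [IsScalarTower R S₂ P₂] (j₂ : N →ₗ[R] P₂)
  (δ₁ δ₂ : P →+ P₂)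

/-- The comparison `(S ⊗_R S) ⊗_R N → P₂`, `(s ⊗ s′) ⊗ n ↦ (ψ₁ s · ψ₂ s′) · j₂ n` (the composite of `lift ψ₁ ψ₂ ⊗ N` with the
base-change identification `S₂ ⊗_R N ≅ P₂`), as an `R`-linear map. [cite: StacksProject, Tag 023M] -/
theorem comparison_tmul (hj₂ : IsBaseChange S₂ j₂) (s s' : S) (n : N) :
    ((hj₂.equiv.restrictScalars R).toLinearMap ∘ₗ
        LinearMap.rTensor N (Algebra.TensorProduct.lift ψ₁ ψ₂ (fun _ _ => Commute.all _ _)).toLinearMap)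
      ((s ⊗ₜ[R] s') ⊗ₜ[R] n) = (ψ₁ s * ψ₂ s') • j₂ n := by
  simp [IsBaseChange.equiv_tmul, Algebra.TensorProduct.lift_tmul]

/-- The comparison `(S ⊗_R S) ⊗_R N → P₂` is injective when `lift ψ₁ ψ₂ : S ⊗_R S → S₂` is bijective (it is then the composite
of two bijections). [cite: StacksProject, Tag 023M] -/
theorem comparison_injective (hj₂ : IsBaseChange S₂ j₂)
    (hψ : Function.Bijective (Algebra.TensorProduct.lift ψ₁ ψ₂ (fun _ _ => Commute.all _ _))) :
    Function.Injective ((hj₂.equiv.restrictScalars R).toLinearMap ∘ₗ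
      LinearMap.rTensor N (Algebra.TensorProduct.lift ψ₁ ψ₂ (fun _ _ => Commute.all _ _)).toLinearMap) := by
  let t : S ⊗[R] S ≃ₗ[R] S₂ :=
    LinearEquiv.ofBijective (Algebra.TensorProduct.lift ψ₁ ψ₂ (fun _ _ => Commute.all _ _)).toLinearMap hψ
  have ht : LinearMap.rTensor N (Algebra.TensorProduct.lift ψ₁ ψ₂ (fun _ _ => Commute.all _ _)).toLinearMap =
      (LinearEquiv.rTensor N t).toLinearMap := by
    ext x
    rfl
  rw [LinearMap.coe_comp, ht]
  exact (hj₂.equiv.restrictScalars R).injective.comp (LinearEquiv.rTensor N t).injective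

/-- `δ₁` read through the base-change identifications: `δ₁ (e y) = T ((includeLeft ⊗ N) y)` for `e = IsBaseChange.equiv` of
`j` and `T` the comparison (both sides are additive in `y` and agree on `s ⊗ n`: `ψ₁ s · j₂ n`). [cite: StacksProject, Tag 023M] -/
theorem delta_one_equiv (hj : IsBaseChange S j) (hj₂ : IsBaseChange S₂ j₂)
    (hδ₁ : ∀ (c : S) (x : P), δ₁ (c • x) = ψ₁ c • δ₁ x) (hδ₁j : ∀ n, δ₁ (j n) = j₂ n) (y : S ⊗[R] N) :
    δ₁ (hj.equiv y) =
      ((hj₂.equiv.restrictScalars R).toLinearMap ∘ₗ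
          LinearMap.rTensor N (Algebra.TensorProduct.lift ψ₁ ψ₂ (fun _ _ => Commute.all _ _)).toLinearMap)
        (LinearMap.rTensor N (Algebra.TensorProduct.includeLeft : S →ₐ[R] S ⊗[R] S).toLinearMap y) := by
  induction y using TensorProduct.induction_on with
  | zero => simp
  | tmul s n =>
      rw [IsBaseChange.equiv_tmul, hδ₁, hδ₁j, LinearMap.rTensor_tmul, AlgHom.toLinearMap_apply,
        Algebra.TensorProduct.includeLeft_apply, comparison_tmul, map_one, mul_one]
  | add x y hx hy => rw [map_add, map_add, hx, hy, map_add, map_add]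

/-- `δ₂` read through the base-change identifications: `δ₂ (e y) = T ((includeRight ⊗ N) y)`. [cite: StacksProject, Tag 023M] -/
theorem delta_two_equiv (hj : IsBaseChange S j) (hj₂ : IsBaseChange S₂ j₂)
    (hδ₂ : ∀ (c : S) (x : P), δ₂ (c • x) = ψ₂ c • δ₂ x) (hδ₂j : ∀ n, δ₂ (j n) = j₂ n) (y : S ⊗[R] N) :
    δ₂ (hj.equiv y) =
      ((hj₂.equiv.restrictScalars R).toLinearMap ∘ₗ
          LinearMap.rTensor N (Algebra.TensorProduct.lift ψ₁ ψ₂ (fun _ _ => Commute.all _ _)).toLinearMap)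
        (LinearMap.rTensor N (Algebra.TensorProduct.includeRight : S →ₐ[R] S ⊗[R] S).toLinearMap y) := by
  induction y using TensorProduct.induction_on with
  | zero => simp
  | tmul s n =>
      rw [IsBaseChange.equiv_tmul, hδ₂, hδ₂j, LinearMap.rTensor_tmul, AlgHom.toLinearMap_apply,
        Algebra.TensorProduct.includeRight_apply, comparison_tmul, map_one, one_mul]
  | add x y hx hy => rw [map_add, map_add, hx, hy, map_add, map_add]

variable [Module.FaithfullyFlat R S]

/-- **The base change map `j : N → P` is injective** (faithful flatness of `R → S`; ★ `mk_one_injective`).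
[cite: StacksProject, Tag 023M] [cite: GortzWedhorn2020, Thm. 14.66] -/
theorem injective_of_isBaseChange (hj : IsBaseChange S j) : Function.Injective j := by
  have h : ⇑j = hj.equiv ∘ TensorProduct.mk R S N 1 := by
    funext n
    simp [IsBaseChange.equiv_tmul]
  rw [h]
  exact hj.equiv.injective.comp (mk_one_injective R S N)

/-- **Amitsur descent in degree zero, base-change data form**: with the data of the module docstring, an element `x ∈ P` is in
the image of `j : N → P` iff its two images `δ₁ x`, `δ₂ x` in `P₂` agree. [cite: StacksProject, Tag 023M]
[cite: GortzWedhorn2020, Thm. 14.66] [cite: SGA1, Exp. VIII Cor. 1.3] -/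
theorem eq_iff_mem_range_of_isBaseChange (hj : IsBaseChange S j) (hj₂ : IsBaseChange S₂ j₂)
    (hψ : Function.Bijective (Algebra.TensorProduct.lift ψ₁ ψ₂ (fun _ _ => Commute.all _ _)))
    (hδ₁ : ∀ (c : S) (x : P), δ₁ (c • x) = ψ₁ c • δ₁ x) (hδ₂ : ∀ (c : S) (x : P), δ₂ (c • x) = ψ₂ c • δ₂ x)
    (hδ₁j : ∀ n, δ₁ (j n) = j₂ n) (hδ₂j : ∀ n, δ₂ (j n) = j₂ n) (x : P) :
    δ₁ x = δ₂ x ↔ x ∈ Set.range j := by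
  obtain ⟨y, rfl⟩ := hj.equiv.surjective x
  rw [delta_one_equiv ψ₁ ψ₂ j j₂ δ₁ hj hj₂ hδ₁ hδ₁j, delta_two_equiv ψ₁ ψ₂ j j₂ δ₂ hj hj₂ hδ₂ hδ₂j,
    (comparison_injective ψ₁ ψ₂ j₂ hj₂ hψ).eq_iff, ← mem_range_mk_one_iff_rTensor]
  constructor
  · rintro ⟨n, hn⟩
    exact ⟨n, by rw [← hn, TensorProduct.mk_apply, IsBaseChange.equiv_tmul, one_smul]⟩
  · rintro ⟨n, hn⟩
    refine ⟨n, hj.equiv.injective ?_⟩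
    rw [TensorProduct.mk_apply, IsBaseChange.equiv_tmul, one_smul, hn]

/-- `∃!` form: an element of `P` whose two images in `P₂` agree comes from a UNIQUE element of `N`.
[cite: StacksProject, Tag 023M] [cite: GortzWedhorn2020, Thm. 14.66] -/
theorem existsUnique_of_isBaseChange (hj : IsBaseChange S j) (hj₂ : IsBaseChange S₂ j₂)
    (hψ : Function.Bijective (Algebra.TensorProduct.lift ψ₁ ψ₂ (fun _ _ => Commute.all _ _)))
    (hδ₁ : ∀ (c : S) (x : P), δ₁ (c • x) = ψ₁ c • δ₁ x) (hδ₂ : ∀ (c : S) (x : P), δ₂ (c • x) = ψ₂ c • δ₂ x)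
    (hδ₁j : ∀ n, δ₁ (j n) = j₂ n) (hδ₂j : ∀ n, δ₂ (j n) = j₂ n) (x : P) (hx : δ₁ x = δ₂ x) :
    ∃! n : N, j n = x := by
  obtain ⟨n, rfl⟩ := (eq_iff_mem_range_of_isBaseChange ψ₁ ψ₂ j j₂ δ₁ δ₂ hj hj₂ hψ hδ₁ hδ₂ hδ₁j hδ₂j x).1 hx
  exact ⟨n, rfl, fun n' h => injective_of_isBaseChange j hj h⟩

end Literature.RingTheory.Flat
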